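import Mathlib.FieldTheory.PerfectClosure
import Mathlib.RingTheory.Polynomial.Basic
import Mathlib.RingTheory.PrincipalIdealDomain
import Mathlib.RingTheory.UniqueFactorizationDomain.Multiplicity
import Mathlib.Algebra.Field.ZMod
import Mathlib.Algebra.Polynomial.FieldDivision
import Mathlib.RingTheory.Ideal.GoingUp
import Mathlib.RingTheory.IntegralClosure.IsIntegralClosure.Basic
import HarnessLib

/-!
# `FRationalResolution` — negative lemmas, part 1: the perfect closure of `𝔽_p[X]` and its Frobenius levels

Support (negative) lemmas for crux stmt-ResolutionOfSingularities-15317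
(`Summit.ResolutionOfSingularities.ResolutionOfSingularities.Theses.FrobeniusLadder.FRationalResolution`,
route FrobeniusLadder), filed by the standing disprover (cdisprove cycle 1; work file
`Cruxes/FRationalResolution/Disproof.lean`). Pure commutative algebra behind
`Negative/FiniteTypeLoadBearing.lean` (`LocallyOfFiniteType` is load-bearing in the crux); this file
declares NO definition.

* `Core.mem_span_of_total_of_archimedean` — in a domain whose elements are totally ordered by
  divisibility and which is ARCHIMEDEAN (no non-zero element is divisible by all powers of a non-zero
  non-unit), every finitely generated ideal `(s)` is tightly closed in the crux's inline sense:
  `c ≠ 0 ∧ (∀ e, c·y^(p^e) ∈ span {z^(p^e) | z ∈ (s)}) ⇒ y ∈ (s)` (any base `p ≥ 2`; if `y ∉ (s)` then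
  `(s) ⊆ (y·t)` with `t` a non-unit and `t^(p^e) ∣ c` for all `e`).
* `Witness.*` — the perfect closure `PerfectClosure K p` of a PID `K` of characteristic `p` through its
  Frobenius LEVELS `ℓₙ = (iterateFrobeniusEquiv _ p n)⁻¹ ∘ of : K → PerfectClosure K p` (injective ring maps
  exhausting the ring, all pulling a prime `Q` back to the same prime `(π)` of `K`): it is a domain
  (`isDomain`), root-closed (`exists_pow_eq`), integral over `K` (`isIntegralElem_of`), and at every prime
  `Q` its elements are totally ordered by divisibility (`total_at_prime`) and archimedean
  (`archimedean_at_prime`) — `π`-adic valuation computations in `K`. For `K = 𝔽_p[X]` every non-zero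
  element avoids a non-zero prime (`exists_prime_not_mem`: the generic point of `Spec` is not open).

## Sources
* M. Hochster, C. Huneke, *F-regularity, test elements, and smooth base change*, Trans. AMS 346 (1994),
  §4 (parameter ideals tightly closed). Folklore valuation computation; Mathlib `PerfectClosure`.
-/

set_option linter.dupNamespace false

noncomputable section

/-! ## Core (pure algebra). In a domain whose elements are totally ordered by divisibility and
which is "archimedean" (no non-zero element is divisible by all powers of a non-zero non-unit), every
finitely generated ideal is tightly closed in the route's inline sense (for any base `p ≥ 2`). -/

namespace Summit.ResolutionOfSingularities.ResolutionOfSingularities.Theorems.FRationalResolution.Negative.Core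

variable {A : Type*} [CommRing A]

/-- A minimum for divisibility in a finite set, in a ring totally ordered by divisibility. -/
theorem exists_dvd_forall_of_total (hTD : ∀ a b : A, a ∣ b ∨ b ∣ a) (F : Finset A) :
    ∃ g : A, (∀ a ∈ F, g ∣ a) ∧ (g ∈ F ∨ g = 0) := by
  classical
  induction F using Finset.induction_on with
  | empty => exact ⟨0, by simp, Or.inr rfl⟩
  | @insert a F haF ih =>
    obtain ⟨g, hg, hgF⟩ := ih
    rcases hgF with hgF | rfl
    · rcases hTD a g with h | h
      · refine ⟨a, fun b hb => ?_, Or.inl (Finset.mem_insert_self a F)⟩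
        rcases Finset.mem_insert.mp hb with rfl | hb
        · exact dvd_rfl
        · exact h.trans (hg b hb)
      · refine ⟨g, fun b hb => ?_, Or.inl (Finset.mem_insert_of_mem hgF)⟩
        rcases Finset.mem_insert.mp hb with rfl | hb
        · exact h
        · exact hg b hb
    · -- F has all elements divisible by 0, i.e. F ⊆ {0}
      refine ⟨a, fun b hb => ?_, Or.inl (Finset.mem_insert_self a F)⟩
      rcases Finset.mem_insert.mp hb with rfl | hb
      · exact dvd_rfl
      · have : b = 0 := by simpa using hg b hb
        rw [this]; exact dvd_zero a

/-- CORE. In a domain `A` totally ordered by divisibility and archimedean, for every finite family `s`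
and every `p ≥ 2`: `c ≠ 0` and `c * y ^ p ^ e ∈ span {z ^ p ^ e | z ∈ (s)}` for all `e` force `y ∈ (s)`. -/
theorem mem_span_of_total_of_archimedean [IsDomain A] {p : ℕ} (hp : 2 ≤ p)
    (hTD : ∀ a b : A, a ∣ b ∨ b ∣ a)
    (hAR : ∀ t c : A, t ≠ 0 → ¬ IsUnit t → c ≠ 0 → ∃ n : ℕ, ¬ t ^ n ∣ c)
    {ι : Type*} [Finite ι] (s : ι → A) (y c : A) (hc : c ≠ 0)
    (h : ∀ e : ℕ, c * y ^ p ^ e ∈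
      Ideal.span ((fun z : A => z ^ p ^ e) '' (Ideal.span (Set.range s) : Set A))) :
    y ∈ Ideal.span (Set.range s) := by
  classical
  by_contra hy
  have hy0 : y ≠ 0 := by rintro rfl; exact hy (Ideal.zero_mem _)
  -- every generator is a multiple of y
  have hys : ∀ i, y ∣ s i := fun i => (hTD y (s i)).resolve_right fun ⟨r, hr⟩ =>
    hy (hr ▸ Ideal.mul_mem_right r _ (Ideal.subset_span ⟨i, rfl⟩))
  choose t ht using hys
  -- a divisibility-minimum t₀ among the t i (or 0 if ι is empty)
  haveI := Fintype.ofFinite ι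
  obtain ⟨t₀, ht₀, ht₀mem⟩ := exists_dvd_forall_of_total hTD (Finset.univ.image t)
  have ht₀t : ∀ i, t₀ ∣ t i := fun i => ht₀ _ (Finset.mem_image_of_mem t (Finset.mem_univ i))
  -- (s) ≤ (y t₀)
  have hle : Ideal.span (Set.range s) ≤ Ideal.span {y * t₀} := by
    rw [Ideal.span_le]
    rintro _ ⟨i, rfl⟩
    rw [SetLike.mem_coe, Ideal.mem_span_singleton, ht i]
    exact mul_dvd_mul_left y (ht₀t i)
  -- hence t₀ ^ p ^ e ∣ c for every e
  have hdvd : ∀ e : ℕ, t₀ ^ p ^ e ∣ c := by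
    intro e
    have h1 : Ideal.span ((fun z : A => z ^ p ^ e) '' (Ideal.span (Set.range s) : Set A)) ≤
        Ideal.span {(y * t₀) ^ p ^ e} := by
      rw [Ideal.span_le]
      rintro _ ⟨z, hz, rfl⟩
      rw [SetLike.mem_coe, Ideal.mem_span_singleton]
      exact pow_dvd_pow_of_dvd (Ideal.mem_span_singleton.mp (hle hz)) _
    have h2 := Ideal.mem_span_singleton.mp (h1 (h e))
    rw [mul_pow, mul_comm c] at h2
    exact (mul_dvd_mul_iff_left (pow_ne_zero _ hy0)).mp h2
  rcases eq_or_ne t₀ 0 with rfl | ht₀0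
  · have := hdvd 1
    rw [pow_one, zero_pow (by omega), zero_dvd_iff] at this
    exact hc this
  have ht₀mem' : t₀ ∈ Finset.univ.image t := ht₀mem.resolve_right ht₀0
  obtain ⟨i₀, -, hi₀⟩ := Finset.mem_image.mp ht₀mem'
  have hunit : ¬ IsUnit t₀ := by
    intro hu
    apply hy
    obtain ⟨u, rfl⟩ := hu
    have : y = s i₀ * ↑u⁻¹ := by rw [ht i₀, hi₀, mul_assoc, Units.mul_inv, mul_one]
    rw [this]
    exact Ideal.mul_mem_right _ _ (Ideal.subset_span ⟨i₀, rfl⟩)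
  obtain ⟨n, hn⟩ := hAR t₀ c ht₀0 hunit hc
  exact hn ((pow_dvd_pow t₀ (Nat.lt_pow_self (by omega : 1 < p)).le).trans (hdvd n))

end Summit.ResolutionOfSingularities.ResolutionOfSingularities.Theorems.FRationalResolution.Negative.Core


/-! ## Witness ring: `PerfectClosure K p` (`K` a PID of characteristic `p`, later `𝔽_p[X]`):
Frobenius levels `ℓₙ a = (iterateFrobeniusEquiv _ p n)⁻¹ (of a)`, domain, root-closed, integral over
`K`, and at every prime `Q`: total divisibility and the archimedean property (both "at `Q`", phrased in
the ring itself). No definitions. -/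

namespace Summit.ResolutionOfSingularities.ResolutionOfSingularities.Theorems.FRationalResolution.Negative.Witness

open Polynomial

section Generic

variable (K : Type) [CommRing K] (p : ℕ) [Fact p.Prime] [CharP K p]

/-- The `n`-th Frobenius level `ℓₙ a = (iterateFrobeniusEquiv _ p n)⁻¹ (of a)` is a `pⁿ`-th root of `of a`. -/
theorem level_pow (n : ℕ) (a : K) :
    ((iterateFrobeniusEquiv (PerfectClosure K p) p n).symm (PerfectClosure.of K p a)) ^ p ^ n =
      PerfectClosure.of K p a := by
  rw [← iterateFrobeniusEquiv_def, RingEquiv.apply_symm_apply]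

/-- `ℓₙ a` is the class of `(n, a)` in the perfect closure. -/
theorem level_mk (n : ℕ) (a : K) :
    (iterateFrobeniusEquiv (PerfectClosure K p) p n).symm (PerfectClosure.of K p a) =
      PerfectClosure.mk K p (n, a) := by
  apply (iterateFrobeniusEquiv (PerfectClosure K p) p n).injective
  rw [RingEquiv.apply_symm_apply, iterateFrobeniusEquiv_def, ← iterate_frobenius,
    PerfectClosure.iterate_frobenius_mk]

/-- The levels exhaust the perfect closure. -/
theorem exists_level (x : PerfectClosure K p) :
    ∃ (n : ℕ) (a : K),
      (iterateFrobeniusEquiv (PerfectClosure K p) p n).symm (PerfectClosure.of K p a) = x :=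
  PerfectClosure.induction_on x fun y => ⟨y.1, y.2, level_mk K p y.1 y.2⟩

/-- Raising the level: `ℓ_{n+k} (a^(p^k)) = ℓₙ a`. -/
theorem level_add (n k : ℕ) (a : K) :
    (iterateFrobeniusEquiv (PerfectClosure K p) p (n + k)).symm (PerfectClosure.of K p (a ^ p ^ k)) =
      (iterateFrobeniusEquiv (PerfectClosure K p) p n).symm (PerfectClosure.of K p a) := by
  apply (iterateFrobeniusEquiv (PerfectClosure K p) p (n + k)).injective
  rw [RingEquiv.apply_symm_apply, iterateFrobeniusEquiv_def, pow_add, pow_mul, level_pow, map_pow]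

/-- Raising the level (commuted index): `ℓ_{k+n} (a^(p^k)) = ℓₙ a`. -/
theorem level_add_left (n k : ℕ) (a : K) :
    (iterateFrobeniusEquiv (PerfectClosure K p) p (k + n)).symm (PerfectClosure.of K p (a ^ p ^ k)) =
      (iterateFrobeniusEquiv (PerfectClosure K p) p n).symm (PerfectClosure.of K p a) := by
  rw [Nat.add_comm]; exact level_add K p n k a

/-- Any two elements lie in a common level. -/
theorem exists_level₂ (x y : PerfectClosure K p) :
    ∃ (n : ℕ) (a b : K),
      (iterateFrobeniusEquiv (PerfectClosure K p) p n).symm (PerfectClosure.of K p a) = x ∧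
      (iterateFrobeniusEquiv (PerfectClosure K p) p n).symm (PerfectClosure.of K p b) = y := by
  obtain ⟨n, a, rfl⟩ := exists_level K p x
  obtain ⟨m, b, rfl⟩ := exists_level K p y
  exact ⟨n + m, a ^ p ^ m, b ^ p ^ n, level_add K p n m a, level_add_left K p m n b⟩

/-- `of : K → PerfectClosure K p` is injective for reduced `K`. -/
theorem of_injective [IsReduced K] : Function.Injective (PerfectClosure.of K p) := by
  intro a b h
  have := (PerfectClosure.eq_iff K p (0, a) (0, b)).mp h
  simpa using this

/-- Every level map `ℓₙ` is injective (reduced `K`). -/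
theorem level_injective [IsReduced K] (n : ℕ) :
    Function.Injective fun a : K =>
      (iterateFrobeniusEquiv (PerfectClosure K p) p n).symm (PerfectClosure.of K p a) :=
  (iterateFrobeniusEquiv (PerfectClosure K p) p n).symm.injective.comp (of_injective K p)

/-- All levels pull a prime `Q` back to the SAME prime `Q.comap of` of `K` (primes are radical). -/
theorem level_mem_iff (Q : Ideal (PerfectClosure K p)) [hQ : Q.IsPrime] (n : ℕ) (a : K) :
    (iterateFrobeniusEquiv (PerfectClosure K p) p n).symm (PerfectClosure.of K p a) ∈ Q ↔
      a ∈ Q.comap (PerfectClosure.of K p) := by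
  rw [Ideal.mem_comap]
  constructor
  · intro h
    have := Q.pow_mem_of_mem h (p ^ n) (pow_pos (Fact.out : p.Prime).pos _)
    rwa [level_pow] at this
  · intro h
    apply hQ.mem_of_pow_mem (p ^ n)
    rwa [level_pow]

/-- The perfect closure of a domain is a domain. -/
theorem isDomain [IsDomain K] : IsDomain (PerfectClosure K p) := by
  haveI : NoZeroDivisors (PerfectClosure K p) := ⟨fun {x y} h => by
    obtain ⟨n, a, b, rfl, rfl⟩ := exists_level₂ K p x y
    rw [← map_mul, ← map_mul] at h
    have h' : (iterateFrobeniusEquiv (PerfectClosure K p) p n).symm (PerfectClosure.of K p (a * b)) =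
        (iterateFrobeniusEquiv (PerfectClosure K p) p n).symm (PerfectClosure.of K p 0) := by
      rw [h, map_zero, map_zero]
    have hab : a * b = 0 := level_injective K p n h'
    rcases mul_eq_zero.mp hab with h0 | h0
    · left; rw [h0, map_zero, map_zero]
    · right; rw [h0, map_zero, map_zero]⟩
  exact NoZeroDivisors.to_isDomain _

/-- The perfect closure is root-closed: every element is a `p`-th power. -/
theorem exists_pow_eq (x : PerfectClosure K p) : ∃ y : PerfectClosure K p, y ^ p = x :=
  ⟨(frobeniusEquiv _ p).symm x, frobeniusEquiv_symm_pow_p _ p x⟩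

/-- Every element of the perfect closure is integral over `K` (root of `X^(p^n) - a`). -/
theorem isIntegralElem_of (x : PerfectClosure K p) :
    (PerfectClosure.of K p).IsIntegralElem x := by
  obtain ⟨n, a, rfl⟩ := exists_level K p x
  refine ⟨X ^ p ^ n - C a, monic_X_pow_sub_C a (pow_ne_zero n (Fact.out : p.Prime).ne_zero), ?_⟩
  rw [eval₂_sub, eval₂_X_pow, eval₂_C, level_pow, sub_self]

variable [IsDomain K] [IsPrincipalIdealRing K]

/-- TOTAL DIVISIBILITY at a prime `Q` of the perfect closure of a PID. -/
theorem total_at_prime (Q : Ideal (PerfectClosure K p)) [hQ : Q.IsPrime]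
    (x y : PerfectClosure K p) :
    (∃ u ∉ Q, ∃ r, y * u = x * r) ∨ (∃ u ∉ Q, ∃ r, x * u = y * r) := by
  obtain ⟨n, a, b, rfl, rfl⟩ := exists_level₂ K p x y
  set L : K →+* PerfectClosure K p :=
    ((iterateFrobeniusEquiv (PerfectClosure K p) p n).symm : PerfectClosure K p ≃+* _).toRingHom.comp
      (PerfectClosure.of K p) with hL
  have hLapp : ∀ z, L z = (iterateFrobeniusEquiv (PerfectClosure K p) p n).symm
      (PerfectClosure.of K p z) := fun z => rfl
  have h1Q : (1 : PerfectClosure K p) ∉ Q := (Ideal.ne_top_iff_one Q).mp hQ.ne_top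
  have hmem : ∀ z, L z ∈ Q ↔ z ∈ Q.comap (PerfectClosure.of K p) := fun z =>
    (hLapp z) ▸ level_mem_iff K p Q n z
  rw [← hLapp, ← hLapp]
  by_cases ha0 : a = 0
  · exact Or.inr ⟨1, h1Q, 0, by simp [ha0]⟩
  by_cases hb0 : b = 0
  · exact Or.inl ⟨1, h1Q, 0, by simp [hb0]⟩
  set P : Ideal K := Q.comap (PerfectClosure.of K p) with hPdef
  by_cases hP : P = ⊥
  · refine Or.inl ⟨L a, fun h => ha0 ?_, L b, mul_comm _ _⟩
    have : a ∈ P := (hmem a).mp h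
    rw [hP] at this
    exact this
  haveI : P.IsPrime := Ideal.comap_isPrime _ _
  set π := Submodule.IsPrincipal.generator P with hπdef
  have hπ : Prime π := Submodule.IsPrincipal.prime_generator_of_isPrime P hP
  have hPmem : ∀ z, z ∈ P ↔ π ∣ z := fun z => Submodule.IsPrincipal.mem_iff_generator_dvd P
  obtain ⟨i, a', ha', rfl⟩ := WfDvdMonoid.max_power_factor ha0 hπ.irreducible
  obtain ⟨j, b', hb', rfl⟩ := WfDvdMonoid.max_power_factor hb0 hπ.irreducible
  have ha'Q : L a' ∉ Q := fun h => ha' ((hPmem a').mp ((hmem a').mp h))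
  have hb'Q : L b' ∉ Q := fun h => hb' ((hPmem b').mp ((hmem b').mp h))
  rcases le_total i j with hij | hji
  · obtain ⟨k, rfl⟩ := Nat.exists_eq_add_of_le hij
    refine Or.inl ⟨L a', ha'Q, L (π ^ k * b'), ?_⟩
    rw [← map_mul, ← map_mul]
    congr 1
    ring
  · obtain ⟨k, rfl⟩ := Nat.exists_eq_add_of_le hji
    refine Or.inr ⟨L b', hb'Q, L (π ^ k * a'), ?_⟩
    rw [← map_mul, ← map_mul]
    congr 1
    ring

/-- ARCHIMEDEAN PROPERTY at a prime `Q` of the perfect closure of a PID: a non-zero `c` is not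
divisible "at `Q`" by all powers of a non-zero `t ∈ Q`. -/
theorem archimedean_at_prime (Q : Ideal (PerfectClosure K p)) [hQ : Q.IsPrime]
    (t c : PerfectClosure K p) (htQ : t ∈ Q) (ht0 : t ≠ 0) (hc0 : c ≠ 0) :
    ∃ N : ℕ, ∀ w ∉ Q, ∀ d : PerfectClosure K p, c * w ≠ t ^ N * d := by
  obtain ⟨n, t₀, c₀, rfl, rfl⟩ := exists_level₂ K p t c
  set P : Ideal K := Q.comap (PerfectClosure.of K p) with hPdef
  haveI : P.IsPrime := Ideal.comap_isPrime _ _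
  have ht₀0 : t₀ ≠ 0 := by rintro rfl; exact ht0 (by rw [map_zero, map_zero])
  have hc₀0 : c₀ ≠ 0 := by rintro rfl; exact hc0 (by rw [map_zero, map_zero])
  have ht₀P : t₀ ∈ P := (level_mem_iff K p Q n t₀).mp htQ
  have hP : P ≠ ⊥ := fun h => ht₀0 (by rw [h] at ht₀P; exact ht₀P)
  set π := Submodule.IsPrincipal.generator P with hπdef
  have hπ : Prime π := Submodule.IsPrincipal.prime_generator_of_isPrime P hP
  have hPmem : ∀ z, z ∈ P ↔ π ∣ z := fun z => Submodule.IsPrincipal.mem_iff_generator_dvd P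
  have hπt : π ∣ t₀ := (hPmem t₀).mp ht₀P
  obtain ⟨r, c', hc', hc_eq⟩ := WfDvdMonoid.max_power_factor hc₀0 hπ.irreducible
  refine ⟨r + 1, fun w hw d hEq => ?_⟩
  obtain ⟨m, w₀, d₀, rfl, rfl⟩ := exists_level₂ K p w d
  have hw₀ : ¬ π ∣ w₀ := fun h => hw ((level_mem_iff K p Q m w₀).mpr ((hPmem w₀).mpr h))
  -- move everything to the common level n + m
  rw [← level_add K p n m c₀, ← level_add K p n m t₀, ← level_add_left K p m n w₀,
    ← level_add_left K p m n d₀] at hEq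
  have key : c₀ ^ p ^ m * w₀ ^ p ^ n = (t₀ ^ p ^ m) ^ (r + 1) * d₀ ^ p ^ n := by
    apply level_injective K p (n + m)
    simpa only [map_mul, map_pow] using hEq
  have h2 : (π ^ p ^ m) ^ (r + 1) ∣ c₀ ^ p ^ m * w₀ ^ p ^ n := by
    rw [key]
    exact (pow_dvd_pow_of_dvd (pow_dvd_pow_of_dvd hπt _) _).mul_right _
  rw [hc_eq] at h2
  have e1 : (π ^ p ^ m) ^ (r + 1) = π ^ (p ^ m * r) * π ^ p ^ m := by rw [pow_succ, ← pow_mul]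
  have e2 : (π ^ r * c') ^ p ^ m * w₀ ^ p ^ n = π ^ (p ^ m * r) * (c' ^ p ^ m * w₀ ^ p ^ n) := by
    rw [mul_pow, ← pow_mul, mul_comm r, mul_assoc]
  rw [e1, e2] at h2
  have h4 : π ^ p ^ m ∣ c' ^ p ^ m * w₀ ^ p ^ n :=
    (mul_dvd_mul_iff_left (pow_ne_zero _ hπ.ne_zero)).mp h2
  have h5 : π ∣ c' ^ p ^ m * w₀ ^ p ^ n :=
    (dvd_pow_self π (pow_ne_zero m (Fact.out : p.Prime).ne_zero)).trans h4
  rcases hπ.dvd_or_dvd h5 with h6 | h6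
  · exact hc' (hπ.dvd_of_dvd_pow h6)
  · exact hw₀ (hπ.dvd_of_dvd_pow h6)

end Generic

/-! ### The polynomial ring `𝔽_p[X]`: every non-zero element avoids a non-zero prime of the perfect
closure -/

section Poly

variable (p : ℕ) [Fact p.Prime]

/-- `𝔽_p[X]` has a prime not dividing any given `f ≠ 0` (an irreducible factor of `f·X + 1`). -/
theorem exists_prime_not_dvd (f : (ZMod p)[X]) (hf : f ≠ 0) :
    ∃ π : (ZMod p)[X], Prime π ∧ ¬ π ∣ f := by
  have hdeg : (f * X + 1 : (ZMod p)[X]).natDegree = f.natDegree + 1 := by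
    rw [Polynomial.natDegree_add_eq_left_of_natDegree_lt] <;>
      rw [Polynomial.natDegree_mul_X hf]
    simp
  have hne : (f * X + 1 : (ZMod p)[X]) ≠ 0 := by
    intro h0; rw [h0] at hdeg; simp at hdeg
  have hnu : ¬ IsUnit (f * X + 1 : (ZMod p)[X]) := by
    intro hu
    have := Polynomial.natDegree_eq_zero_of_isUnit hu
    omega
  obtain ⟨π, hπirr, hπdvd⟩ := WfDvdMonoid.exists_irreducible_factor hnu hne
  refine ⟨π, hπirr.prime, fun hdf => hπirr.not_isUnit ?_⟩
  have : π ∣ (f * X + 1) - f * X := dvd_sub hπdvd (dvd_mul_of_dvd_left hdf _)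
  exact isUnit_of_dvd_one (by simpa using this)

/-- The generic point of `Spec 𝔽_p[X^{1/p^∞}]` is not open: every `f ≠ 0` avoids some non-zero prime
(lying over `(π)`, `π ∤ f₀` where `f = ℓₙ f₀`; the perfect closure is integral over `𝔽_p[X]`). -/
theorem exists_prime_not_mem (f : PerfectClosure (ZMod p)[X] p) (hf : f ≠ 0) :
    ∃ Q : Ideal (PerfectClosure (ZMod p)[X] p), Q.IsPrime ∧ Q ≠ ⊥ ∧ f ∉ Q := by
  obtain ⟨n, f₀, rfl⟩ := exists_level (ZMod p)[X] p f
  have hf₀ : f₀ ≠ 0 := by rintro rfl; exact hf (by rw [map_zero, map_zero])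
  obtain ⟨π, hπ, hπf⟩ := exists_prime_not_dvd p f₀ hf₀
  let P₁ : Ideal (ZMod p)[X] := Ideal.span {π}
  haveI hP₁ : P₁.IsPrime := (Ideal.span_singleton_prime hπ.ne_zero).mpr hπ
  letI : Algebra (ZMod p)[X] (PerfectClosure (ZMod p)[X] p) := (PerfectClosure.of (ZMod p)[X] p).toAlgebra
  haveI : Algebra.IsIntegral (ZMod p)[X] (PerfectClosure (ZMod p)[X] p) :=
    ⟨fun x => isIntegralElem_of (ZMod p)[X] p x⟩
  have hinj := of_injective (ZMod p)[X] p
  obtain ⟨Q, -, hQ, hQcomap⟩ := Ideal.exists_ideal_over_prime_of_isIntegral P₁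
    (⊥ : Ideal (PerfectClosure (ZMod p)[X] p))
    (by
      intro a ha
      have ha0 : PerfectClosure.of (ZMod p)[X] p a = 0 := Ideal.mem_bot.mp (Ideal.mem_comap.mp ha)
      have : a = 0 := hinj (by rw [ha0, map_zero])
      rw [this]; exact P₁.zero_mem)
  have hcomap : Q.comap (PerfectClosure.of (ZMod p)[X] p) = P₁ := hQcomap
  haveI := hQ
  refine ⟨Q, hQ, ?_, ?_⟩
  · rintro rfl
    have hπmem : π ∈ (⊥ : Ideal (PerfectClosure (ZMod p)[X] p)).comap (PerfectClosure.of (ZMod p)[X] p) := by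
      rw [hcomap]; exact Ideal.mem_span_singleton_self π
    have hπ0 : PerfectClosure.of (ZMod p)[X] p π = 0 := by
      simpa [Ideal.mem_comap] using hπmem
    exact hπ.ne_zero (hinj (by rw [hπ0, map_zero]))
  · intro hfQ
    have h1 : f₀ ∈ Q.comap (PerfectClosure.of (ZMod p)[X] p) :=
      (level_mem_iff (ZMod p)[X] p Q n f₀).mp hfQ
    rw [hcomap] at h1
    exact hπf (Ideal.mem_span_singleton.mp h1)

end Poly

end Summit.ResolutionOfSingularities.ResolutionOfSingularities.Theorems.FRationalResolution.Negative.Witness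



end
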